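import Summits.CriticalPhenomena.PercolationContinuityZ3.Theorems.PercNearOneGluingNoHeavyQuantHalfMeanTransport
import HarnessLib

/-!
# QUANT lane R8, FAR caricature II: the independent-blob caricature ("half-mean small-ball inequality") — proved

builds on p205010 (kernel theorem, internal audit signed; external expert review pending)

Support file (`--supports stmt-CriticalPhenomena-4575`), QUANT lane seat prim-quant-p2 (gen 20), rung R8 of
`run/shared/lean/prim/quant/LADDER.md`, for the R8 target of record `Quant.FarRelayRow` (lead g4, p214662;
memo `prim-quant-lead-g4/LEAD-NOTES-G4.md` N11 (5), (9)).  Theorems only; no definitions, no sorries, standard axioms.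
Part I is `…QuantHalfMeanTransport.lean` (Harris–Kleitman / Hall transport; `Quant.halfMean_smallBall_of_card`).

In the FIBRE / BLOCK-STAR picture of FAR (N11 (5)) the observer's relay count is `X = Σ_i a_i ε_i` with
INDEPENDENT gates `ε_i ~ Bern(p_i)` and integer blob sizes `a_i`; the "independent-blob caricature" of FAR is
`E X > 2j ⟹ P(X ≤ j) ≤ max_i (1 − p_i)`, with equality on the glue family (N11 (5)–(6); lead g5 STATUS
2026-08-20T10:32Z: 'open: min gate > 1/2').  This file PROVES it:

* `Quant.lightEvent_cantelli` — Cantelli / one-sided Chebyshev for the light event on the weighted cube: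
  with `m = E X = Σ a_i p_i > j`, all `a_i ≤ j`, all `1 − p_i ≤ t`:  `4(m−j)² P(X ≤ j) ≤ j t m + (m−j)²`
  (Markov on `(m − X + (m−j))²`; `Var X = Σ a_i² p_i (1−p_i) ≤ j t m`, computed from the one- and two-point
  marginals of `prodBernoulli`).
* `Quant.halfMean_smallBall` — **the caricature**: `2j < Σ_i a_i p_i` and `1 − p_i ≤ t` for all `i` imply
  `P(X ≤ j) ≤ t`, for `prodBernoulli p` on `Set ι` (`ι` finite), `X(s) = Σ_{i∈s} a_i`, in FAR's shape.
  Cases: a blob of size `≥ j+1` (then `{X ≤ j} ⊆ {ε_i = 0}`); else `t ≥ 1/2` by `lightEvent_cantelli`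
  (`λ = m − j > m/2`, `j t m ≤ 2tλ²`, so `P ≤ (2t+1)/4 ≤ t`); else `t < 1/2` and `Σ a_i ≥ 2j+1`, Part I.
  Equivalently `E X > 2j ⟹ P(X ≥ j+1) ≥ min_i p_i`; equality on FAR's glue family
  (`j` glued unit blobs + one `(j+1)`-blob at gate `g > j/(j+1)`); `2j` cannot be lowered (two unit blobs, `j = 1`).

The graph embedding (block-stars: `o` joined to hubs `v_i` by single edges of weight `p_i`, hub `v_i` glued to
`a_i` relays; `N_o = X` a.s.) is left to the owner of the FAR file.  [cite: KozmaNitzan2024, Lemma 2 (p. 6), Conjecture 3 (p. 15)]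
-/

noncomputable section

namespace Summit.CriticalPhenomena.PercolationContinuityZ3.Theorems

open MeasureTheory Set Finset
open Literature.Probability.LatticeModels
open Literature.Probability.Percolation (prodBernoulli_real_eq_sum_weight_ind)
open Literature.Probability.Percolation.BHK2006 (weight weight_nonneg)
open Literature.Probability.Percolation.DecisionTree (ind ind_of_mem ind_of_not_mem ind_nonneg)
open scoped Classical

namespace Quant

variable {ι : Type*} [Fintype ι]

/-! ### 5. Cantelli in the low-gate regime, and the caricature -/

/-- The relay mass of a configuration as a real number: `Σ_{i∈s} a i = Σ_i a_i · 1[i ∈ s]`. [folklore] -/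
theorem mass_cast_eq_sum_ind (a : ι → ℕ) (s : Set ι) :
    ((∑ i ∈ univ.filter (fun i => i ∈ s), a i : ℕ) : ℝ) = ∑ i, (a i : ℝ) * ind {s' : Set ι | i ∈ s'} s := by
  rw [Finset.sum_filter, Nat.cast_sum]
  refine Finset.sum_congr rfl fun i _ => ?_
  by_cases hi : i ∈ s
  · rw [if_pos hi, ind_of_mem (show s ∈ {s' : Set ι | i ∈ s'} from hi), mul_one]
  · rw [if_neg hi, ind_of_not_mem (show s ∉ {s' : Set ι | i ∈ s'} from hi), mul_zero, Nat.cast_zero]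

/-- **Cantelli bound for the light event.**  With `W` the `prodBernoulli p` weights, `X(s) = Σ_{i∈s} a_i`,
`m = E X = Σ a_i p_i > 2j`, all `a_i ≤ j` and all `1 − p_i ≤ t`: `4 (m − j)² · P(X ≤ j) ≤ j·t·m + (m − j)²`
(Markov on `(m − X + (m−j))²`, `Var X = Σ a_i² p_i (1 − p_i) ≤ j t m`). [folklore; Cantelli 1928 / one-sided Chebyshev] -/
theorem lightEvent_cantelli (p : ι → unitInterval) (a : ι → ℕ) (j : ℕ) (t : ℝ)
    (ha : ∀ i, a i ≤ j) (ht : ∀ i, 1 - (p i : ℝ) ≤ t) (hjm : (j : ℝ) < ∑ i, (a i : ℝ) * (p i : ℝ)) :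
    4 * ((∑ i, (a i : ℝ) * (p i : ℝ)) - j) ^ 2 *
        (prodBernoulli p).real {s : Set ι | ∑ i ∈ univ.filter (fun i => i ∈ s), a i ≤ j} ≤
      (j : ℝ) * t * (∑ i, (a i : ℝ) * (p i : ℝ)) + ((∑ i, (a i : ℝ) * (p i : ℝ)) - j) ^ 2 := by
  set μ := prodBernoulli p with hμ
  set E : Set (Set ι) := {s : Set ι | ∑ i ∈ univ.filter (fun i => i ∈ s), a i ≤ j} with hE
  set W : Set ι → ℝ := weight (fun e => (p e : ℝ)) with hW
  set X : Set ι → ℝ := fun s => ∑ i, (a i : ℝ) * ind {s' : Set ι | i ∈ s'} s with hX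
  set m : ℝ := ∑ i, (a i : ℝ) * (p i : ℝ) with hm
  set lam : ℝ := m - j with hlam
  have hp0 : ∀ i, (0 : ℝ) ≤ p i := fun i => (p i).2.1
  have hp1 : ∀ i, (p i : ℝ) ≤ 1 := fun i => (p i).2.2
  have hW0 : ∀ s, 0 ≤ W s := fun s => weight_nonneg hp0 hp1 s
  -- (W1) total mass one
  have hW1 : ∑ s, W s = 1 := by
    have h := prodBernoulli_real_eq_sum_weight_ind p (Set.univ : Set (Set ι))
    rw [probReal_univ] at h
    rw [h]
    refine Finset.sum_congr rfl fun s _ => ?_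
    rw [ind_of_mem (Set.mem_univ s), mul_one]
  -- (W2) one-point marginals
  have hW2 : ∀ i, ∑ s, W s * ind {s' : Set ι | i ∈ s'} s = p i := by
    intro i
    rw [← prodBernoulli_real_eq_sum_weight_ind p {s' : Set ι | i ∈ s'}, prodBernoulli_real_setOf_mem]
  -- (W3) two-point marginals
  have hW3 : ∀ i i', i ≠ i' →
      ∑ s, W s * (ind {s' : Set ι | i ∈ s'} s * ind {s' : Set ι | i' ∈ s'} s) = p i * p i' := by
    intro i i' hii'
    have hset : ({s' : Set ι | i ∈ s'} ∩ {s' : Set ι | i' ∈ s'}) =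
        {ω : Set ι | ((({i, i'} : Finset ι) : Set ι)) ⊆ ω} := by
      ext ω
      simp [Set.insert_subset_iff]
    have h := prodBernoulli_real_eq_sum_weight_ind p ({s' : Set ι | i ∈ s'} ∩ {s' : Set ι | i' ∈ s'})
    simp_rw [Literature.Probability.Percolation.BHK2006.ind_inter] at h
    rw [← h, hset, prodBernoulli_real_subset, Finset.prod_pair hii']
  -- mean
  have hmean : ∑ s, W s * X s = m := by
    simp_rw [hX, Finset.mul_sum]
    rw [Finset.sum_comm]
    refine Finset.sum_congr rfl fun i _ => ?_
    have : ∑ s, W s * ((a i : ℝ) * ind {s' : Set ι | i ∈ s'} s) =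
        (a i : ℝ) * ∑ s, W s * ind {s' : Set ι | i ∈ s'} s := by
      rw [Finset.mul_sum]
      exact Finset.sum_congr rfl fun s _ => by ring
    rw [this, hW2 i]
  -- second moment minus squared mean = Σ a_i² p_i (1 - p_i)
  have hpair : ∀ i i', ∑ s, W s * (ind {s' : Set ι | i ∈ s'} s * ind {s' : Set ι | i' ∈ s'} s) =
      if i = i' then (p i : ℝ) else p i * p i' := by
    intro i i'
    by_cases hii' : i = i'
    · subst hii'
      rw [if_pos rfl, ← hW2 i]
      refine Finset.sum_congr rfl fun s _ => ?_
      by_cases hs : s ∈ {s' : Set ι | i ∈ s'}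
      · rw [ind_of_mem hs, mul_one]
      · rw [ind_of_not_mem hs, mul_zero]
    · rw [if_neg hii', hW3 i i' hii']
  have hvar : ∑ s, W s * (X s - m) ^ 2 = ∑ i, (a i : ℝ) ^ 2 * (p i : ℝ) * (1 - p i) := by
    -- expand the square
    have hexp : ∀ s, W s * (X s - m) ^ 2 = W s * X s ^ 2 - 2 * m * (W s * X s) + m ^ 2 * W s := by
      intro s; ring
    simp_rw [hexp]
    rw [Finset.sum_add_distrib, Finset.sum_sub_distrib, ← Finset.mul_sum, ← Finset.mul_sum, hmean, hW1]
    -- the second moment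
    have hsq : ∀ s, X s ^ 2 = ∑ i, ∑ i', (a i : ℝ) * (a i' : ℝ) *
        (ind {s' : Set ι | i ∈ s'} s * ind {s' : Set ι | i' ∈ s'} s) := by
      intro s
      rw [hX, sq, Finset.sum_mul_sum]
      refine Finset.sum_congr rfl fun i _ => Finset.sum_congr rfl fun i' _ => by ring
    have hQ : ∑ s, W s * X s ^ 2 = ∑ i, ∑ i', (a i : ℝ) * (a i' : ℝ) *
        (if i = i' then (p i : ℝ) else p i * p i') := by
      simp_rw [hsq, Finset.mul_sum]
      rw [Finset.sum_comm]
      refine Finset.sum_congr rfl fun i _ => ?_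
      rw [Finset.sum_comm]
      refine Finset.sum_congr rfl fun i' _ => ?_
      rw [← hpair i i', Finset.mul_sum]
      exact Finset.sum_congr rfl fun s _ => by ring
    have hm2 : m ^ 2 = ∑ i, ∑ i', (a i : ℝ) * (a i' : ℝ) * ((p i : ℝ) * p i') := by
      rw [hm, sq, Finset.sum_mul_sum]
      refine Finset.sum_congr rfl fun i _ => Finset.sum_congr rfl fun i' _ => by ring
    rw [hQ]
    have : ∑ i, ∑ i', (a i : ℝ) * (a i' : ℝ) * (if i = i' then (p i : ℝ) else p i * p i') -
        2 * m * m + m ^ 2 * 1 =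
        ∑ i, ∑ i', (a i : ℝ) * (a i' : ℝ) * (if i = i' then (p i : ℝ) else p i * p i') - m ^ 2 := by ring
    rw [this, hm2, ← Finset.sum_sub_distrib]
    refine Finset.sum_congr rfl fun i _ => ?_
    rw [← Finset.sum_sub_distrib]
    have hterm : ∀ i', (a i : ℝ) * (a i' : ℝ) * (if i = i' then (p i : ℝ) else p i * p i') -
        (a i : ℝ) * (a i' : ℝ) * ((p i : ℝ) * p i') =
        if i = i' then (a i : ℝ) ^ 2 * (p i : ℝ) * (1 - p i) else 0 := by
      intro i'
      by_cases h : i = i'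
      · subst h; rw [if_pos rfl, if_pos rfl]; ring
      · rw [if_neg h, if_neg h]; ring
    simp_rw [hterm]
    rw [Finset.sum_ite_eq]
    simp
  -- variance bound `Var ≤ j t m`
  have hvarle : ∑ s, W s * (X s - m) ^ 2 ≤ (j : ℝ) * t * m := by
    rw [hvar, hm, Finset.mul_sum]
    refine Finset.sum_le_sum fun i _ => ?_
    have h1 : (a i : ℝ) ≤ j := by exact_mod_cast ha i
    have h2 : (0 : ℝ) ≤ a i := Nat.cast_nonneg _
    have h3 : 1 - (p i : ℝ) ≤ t := ht i
    have h4 : 0 ≤ 1 - (p i : ℝ) := by linarith [hp1 i]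
    have h5 : (a i : ℝ) * (1 - p i) ≤ j * t := mul_le_mul h1 h3 h4 (Nat.cast_nonneg _)
    calc (a i : ℝ) ^ 2 * (p i : ℝ) * (1 - p i) = ((a i : ℝ) * p i) * ((a i : ℝ) * (1 - p i)) := by ring
      _ ≤ ((a i : ℝ) * p i) * (j * t) := mul_le_mul_of_nonneg_left h5 (mul_nonneg h2 (hp0 i))
      _ = (j : ℝ) * t * ((a i : ℝ) * p i) := by ring
  -- Markov on the square `(m - X + lam)^2`
  have hPE : μ.real E = ∑ s, W s * ind E s := prodBernoulli_real_eq_sum_weight_ind p E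
  have hmarkov : 4 * lam ^ 2 * μ.real E ≤ ∑ s, W s * (m - X s + lam) ^ 2 := by
    rw [hPE, Finset.mul_sum]
    refine Finset.sum_le_sum fun s _ => ?_
    by_cases hs : s ∈ E
    · rw [ind_of_mem hs, mul_one]
      have hXle : X s ≤ j := by
        have h1 : ((∑ i ∈ univ.filter (fun i => i ∈ s), a i : ℕ) : ℝ) ≤ (j : ℝ) := by
          exact_mod_cast (show s ∈ E from hs)
        rw [mass_cast_eq_sum_ind] at h1
        exact h1
      have h2 : 2 * lam ≤ m - X s + lam := by rw [hlam]; linarith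
      have hl : 0 ≤ lam := by rw [hlam]; linarith
      have h3 : (2 * lam) ^ 2 ≤ (m - X s + lam) ^ 2 := pow_le_pow_left₀ (by linarith) h2 2
      nlinarith [hW0 s, h3]
    · rw [ind_of_not_mem hs, mul_zero, mul_zero]
      exact mul_nonneg (hW0 s) (sq_nonneg _)
  have hexp2 : ∑ s, W s * (m - X s + lam) ^ 2 = ∑ s, W s * (X s - m) ^ 2 + lam ^ 2 := by
    have : ∀ s, W s * (m - X s + lam) ^ 2 =
        W s * (X s - m) ^ 2 - 2 * lam * (W s * X s) + (2 * lam * m + lam ^ 2) * W s := by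
      intro s; ring
    simp_rw [this]
    rw [Finset.sum_add_distrib, Finset.sum_sub_distrib, ← Finset.mul_sum, ← Finset.mul_sum, hmean, hW1]
    ring
  rw [hexp2] at hmarkov
  linarith

/-- **The independent-blob caricature of FAR ("half-mean small-ball inequality").**  For independent gates
`p_i ∈ [0,1]` (`prodBernoulli p` on `Set ι`, `ι` finite), integer blob sizes `a_i` and `j : ℕ`: if
`2j < Σ_i a_i p_i` (`= E X`, `X(s) = Σ_{i∈s} a_i`) and `1 − p_i ≤ t` for every `i`, then `P(X ≤ j) ≤ t`.
Equivalently `E X > 2j ⟹ P(X ≥ j+1) ≥ min_i p_i`.  This is FAR (`Quant.FarRelayRow`) for block-stars / in the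
fibre picture (LEAD-NOTES-G4 N11 (5)); equality on the glue family `a = (j glued, one (j+1)-blob at gate g)`.
Proof: a blob of size `≥ j+1` forces its gate shut on `{X ≤ j}`; otherwise `t ≥ 1/2` is `lightEvent_cantelli`
and `t ≤ 1/2` is `halfMean_smallBall_of_card` (total mass `≥ ⌈E X⌉ ≥ 2j+1`). [this work] -/
theorem halfMean_smallBall (p : ι → unitInterval) (a : ι → ℕ) (j : ℕ) (t : ℝ)
    (hmean : (2 * j : ℝ) < ∑ i, (a i : ℝ) * (p i : ℝ)) (ht : ∀ i, 1 - (p i : ℝ) ≤ t) :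
    (prodBernoulli p).real {s : Set ι | ∑ i ∈ univ.filter (fun i => i ∈ s), a i ≤ j} ≤ t := by
  set μ := prodBernoulli p with hμ
  set E : Set (Set ι) := {s : Set ι | ∑ i ∈ univ.filter (fun i => i ∈ s), a i ≤ j} with hE
  have hp0 : ∀ i, (0 : ℝ) ≤ p i := fun i => (p i).2.1
  have hp1 : ∀ i, (p i : ℝ) ≤ 1 := fun i => (p i).2.2
  by_cases hbig : ∃ i, j + 1 ≤ a i
  · -- a heavy blob: `{X ≤ j} ⊆ {i ∉ s}`
    obtain ⟨i, hi⟩ := hbig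
    have hsub : E ⊆ {s : Set ι | i ∉ s} := by
      intro s hs his
      have h1 : ∑ i' ∈ univ.filter (fun i' => i' ∈ s), a i' ≤ j := hs
      have h2 : a i ≤ ∑ i' ∈ univ.filter (fun i' => i' ∈ s), a i' :=
        Finset.single_le_sum (fun _ _ => Nat.zero_le _) (Finset.mem_filter.2 ⟨Finset.mem_univ _, his⟩)
      omega
    calc μ.real E ≤ μ.real {s : Set ι | i ∉ s} := measureReal_mono hsub (measure_ne_top _ _)
      _ = 1 - p i := prodBernoulli_real_setOf_notMem p i
      _ ≤ t := ht i
  · push Not at hbig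
    have ha : ∀ i, a i ≤ j := fun i => Nat.lt_succ_iff.1 (hbig i)
    by_cases ht2 : t ≤ 1 / 2
    · -- high gates: total mass ≥ 2j+1, transport
      have hT : 2 * j + 1 ≤ ∑ i, a i := by
        have h1 : ∑ i, (a i : ℝ) * (p i : ℝ) ≤ ∑ i, (a i : ℝ) :=
          Finset.sum_le_sum fun i _ => by nlinarith [hp1 i, hp0 i, (Nat.cast_nonneg (a i) : (0:ℝ) ≤ a i)]
        have h2 : (2 * j : ℝ) < ((∑ i, a i : ℕ) : ℝ) := by push_cast; linarith
        have h3 : 2 * j < ∑ i, a i := by exact_mod_cast h2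
        omega
      exact halfMean_smallBall_of_card p a j t ht2 ht hT
    · -- a low gate: Cantelli
      push Not at ht2
      have hc := lightEvent_cantelli p a j t ha ht (by linarith [(Nat.cast_nonneg j : (0:ℝ) ≤ j)])
      set m : ℝ := ∑ i, (a i : ℝ) * (p i : ℝ) with hm
      have hj0 : (0 : ℝ) ≤ j := Nat.cast_nonneg _
      have hm0 : 0 < m := by linarith
      have hlam : m / 2 < m - j := by linarith
      have hlam0 : 0 < m - j := by linarith
      -- `j m ≤ 2 (m - j)^2`
      have hjm : (j : ℝ) * m ≤ 2 * (m - j) ^ 2 := by nlinarith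
      have ht0 : 0 ≤ t := by linarith
      have h1 : (j : ℝ) * t * m ≤ 2 * t * (m - j) ^ 2 := by nlinarith
      have h2 : 4 * (m - j) ^ 2 * μ.real E ≤ (2 * t + 1) * (m - j) ^ 2 := by linarith
      have h3 : 4 * μ.real E ≤ 2 * t + 1 := le_of_mul_le_mul_right (by linarith) (pow_pos hlam0 2)
      linarith

end Quant

end Summit.CriticalPhenomena.PercolationContinuityZ3.Theorems

end
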